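import Mathlib.Combinatorics.SimpleGraph.Walk.Decomp
import Literature.Probability.Percolation.Percolation
import Literature.Probability.LatticeModels.LatticeGraph

/-!
# Stub `stub_clusterLocalityV2` of line `rainbow-monomials-in-excursion-kernels` — Part 9:
# first step of the percolation half P1 — the deterministic decomposition of a connection
# (crux `BoundaryDefectGaussianR`, stmt-CriticalPhenomena-14132)

The PERCOLATION HALF P1 of cluster locality for the family `(2;2)` (companion of the landed
Green half `s10_greenLocality`) reads, after the insertion dictionary: for finite `V, V'` flat in
the balls of radius `M·m` about anchors `a, a'` and `x, y` on the anchor row within `m` of `a`,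
`|P_{1/2}[x ↔ y in V] / P_{1/2}[x' ↔ y' in V'] - 1| ≤ ε` once `M ≥ M(ε)`, uniformly in `m ≥ 1`
(critical bond percolation on `ℤ²`, `openConnIn`). Its proof starts from the deterministic
decomposition proved here (`openConnIn_subset_union`, registered sub-goal
`s10_connectionDecomposition`): an open connection from `x` to `y` inside `V` either stays inside
`V ∩ S` (for any window `S`, e.g. the flat ball) or connects BOTH `x` and `y` inside `V` to a
vertex outside `S`. With `S` the flat half-ball, the first event is common to `V` and `V'`, and
the second costs a half-plane arm from the scale `m` to the scale `M·m` at each endpoint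
(RSW/quasi-multiplicativity, not done here). [folklore]
-/

noncomputable section

namespace Summit.CriticalPhenomena.CardyFormulaZ2.Cruxes.BoundaryDefectGaussianR.RainbowMonomialsInExcursionKernels

open Literature.Probability.Percolation Literature.Probability.LatticeModels

/-! ### Walks in induced subgraphs -/

/-- A walk in the subgraph induced on `s` all of whose vertices lie in `t` is a walk in the
subgraph induced on `s ∩ t`. [folklore] -/
theorem reachable_induce_inter_of_walk {α : Type*} {G : SimpleGraph α} {s t : Set α}
    {u v : s} (p : (G.induce s).Walk u v) (h : ∀ w ∈ p.support, (w : α) ∈ t) :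
    (G.induce (s ∩ t)).Reachable ⟨u, u.2, h u p.start_mem_support⟩
      ⟨v, v.2, h v p.end_mem_support⟩ := by
  induction p with
  | nil => exact SimpleGraph.Reachable.refl _
  | cons hadj q ih =>
    rename_i a b c
    have hq : ∀ w ∈ q.support, (w : α) ∈ t := fun w hw =>
      h w (by rw [SimpleGraph.Walk.support_cons]; exact List.mem_cons_of_mem _ hw)
    have ha : (a : α) ∈ t := h a (SimpleGraph.Walk.start_mem_support _)
    have hb : (b : α) ∈ t := hq b q.start_mem_support
    have hadj' : (G.induce (s ∩ t)).Adj ⟨a, a.2, ha⟩ ⟨b, b.2, hb⟩ := by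
      rw [SimpleGraph.induce_adj] at hadj ⊢
      exact hadj
    exact (SimpleGraph.Adj.reachable hadj').trans (ih hq)

/-! ### The decomposition of a connection -/

/-- **Deterministic decomposition of an open connection.** If `x ↔ y` by an open path inside
`V`, then either `x ↔ y` inside `V ∩ S`, or both `x` and `y` are joined inside `V` to some vertex
outside `S` (the first vertex of the path outside `S`). [folklore] -/
theorem openConnIn_subset_union {α : Type*} (V S : Set α) (x y : α) (ω : BondConfig α)
    (hω : ω ∈ openConnIn V x y) :
    ω ∈ openConnIn (V ∩ S) x y ∨
      ((∃ z, z ∉ S ∧ ω ∈ openConnIn V x z) ∧ (∃ z, z ∉ S ∧ ω ∈ openConnIn V y z)) := by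
  classical
  obtain ⟨hx, hy, hreach⟩ := hω
  obtain ⟨p⟩ := hreach
  by_cases hall : ∀ w ∈ p.support, (w : α) ∈ S
  · left
    exact ⟨⟨hx, hall _ p.start_mem_support⟩, ⟨hy, hall _ p.end_mem_support⟩,
      reachable_induce_inter_of_walk p hall⟩
  · right
    push Not at hall
    obtain ⟨w, hw, hwS⟩ := hall
    refine ⟨⟨w, hwS, hx, w.2, ⟨p.takeUntil w hw⟩⟩, ⟨w, hwS, hy, w.2, ⟨(p.dropUntil w hw).reverse⟩⟩⟩

/-- The decomposition for events: `{x ↔ y in V} ⊆ {x ↔ y in V ∩ S} ∪ ({x ↔ Sᶜ in V} ∩ {y ↔ Sᶜ in V})`.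
[folklore] -/
theorem openConnIn_subset (V S : Set (Site 2)) (x y : Site 2) :
    openConnIn V x y ⊆ openConnIn (V ∩ S) x y ∪
      ({ω | ∃ z, z ∉ S ∧ ω ∈ openConnIn V x z} ∩ {ω | ∃ z, z ∉ S ∧ ω ∈ openConnIn V y z}) :=
  fun ω hω => (openConnIn_subset_union V S x y ω hω).elim Or.inl fun h => Or.inr ⟨h.1, h.2⟩

/-- Monotonicity of `openConnIn` in the vertex set. [folklore] -/
theorem openConnIn_mono {α : Type*} {V W : Set α} (hVW : V ⊆ W) (x y : α) :
    openConnIn V x y ⊆ openConnIn W x y := by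
  rintro ω ⟨hx, hy, ⟨p⟩⟩
  refine ⟨hVW hx, hVW hy, ?_⟩
  have := p.map (SimpleGraph.induceHomOfLE (openGraph ω) hVW).toHom
  exact ⟨this⟩

/-! ### Registered sub-goal of the stub carried by this file -/

/-- **Sub-goal `s10_connectionDecomposition`** (registered on stmt-CriticalPhenomena-14132; first
step of the percolation half P1 of `stub_clusterLocalityV2`): an open connection inside `V`
either stays inside `V ∩ S` or joins both endpoints inside `V` to the outside of `S`
(`openConnIn_subset`). [folklore] -/
theorem s10_connectionDecomposition : ∀ (V S : Set (Literature.Probability.LatticeModels.Site 2)) (x y : Literature.Probability.LatticeModels.Site 2), Literature.Probability.Percolation.openConnIn V x y ⊆ Literature.Probability.Percolation.openConnIn (V ∩ S) x y ∪ ({ω | ∃ z, z ∉ S ∧ ω ∈ Literature.Probability.Percolation.openConnIn V x z} ∩ {ω | ∃ z, z ∉ S ∧ ω ∈ Literature.Probability.Percolation.openConnIn V y z}) :=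
  openConnIn_subset

end Summit.CriticalPhenomena.CardyFormulaZ2.Cruxes.BoundaryDefectGaussianR.RainbowMonomialsInExcursionKernels

end
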